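import Summits.CriticalPhenomena.Ising3DConformalLimit.Theorems.MirrorHoelderCompactnessTwoPointDoublingStubGreenComparison
import Summits.CriticalPhenomena.Ising3DConformalLimit.Theses.MirrorHoelderCompactness
import HarnessLib

/-!
# The box comparison lemma (discrete weak-Harnack-lite) and Kato bounds on POWERS of the two-point function

Abstract form of the comparison step behind `stub_greenComparison` (crux `TwoPointDoubling`, stmt-CriticalPhenomena-6150,
line `superharmonic-comparison`), stated for an ARBITRARY positive lattice function so that 6150's ideators can feed it other
supersolution-type information:

* `box_comparison` — if `F > 0` on `ℤ³`, `F ≥ m` on the near face `{x₀ = k, |x₁|, |x₂| < k}` and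
  `ΔF ≤ (B/k²)·F` on the box `Ω_k = {k < x₀ < 8k, |x₁|, |x₂| < k}` (`B ≥ 0`; six-neighbour Laplacian), then
  `F(6k e₀) ≥ (sinh 2c/sinh 7c)·m`, `c = √(π²/2 + B + 1)`.  Only the box is quantified over: the one-sided Kato bound is
  needed on the cone `|x₁|, |x₂| < x₀`, at relative size `k⁻²` on `Ω_k`.  Proof: minimum principle against the exact lattice
  eigenfunction `sinh(μ(8k − x₀)) cos(πx₁/2k) cos(πx₂/2k)` (`lattice_laplacian_prod_eigen`), as in
  `doubling_three_mul_of_kato`.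
* `doubling_three_mul_of_kato_rpow`, `twoPointDoubling_of_kato_rpow` — a one-parameter WEAKENING of the funnel hypothesis: if for
  some `θ > 0` the power `G^θ` (`G = criticalTwoPoint 3`) satisfies the one-sided Kato bound `Δ(G^θ) ≤ A·G^θ/‖x‖²` (`x ≠ 0`), then
  `TwoPointDoubling` holds (constant `κ₀^{1/θ}·r³`).  By Jensen (power means increase with the exponent) the hypothesis gets WEAKER as
  `θ ↓ 0`; in continuum language it reads `Δ log G + θ|∇ log G|² ≤ A_θ/r²`, i.e. for small `θ` essentially one-sided control of the
  LOG-LAPLACIAN (`log G` almost superharmonic: true for powers `r^{-a}` and for a single Yukawa `e^{-r/M}/r`, false exactly in the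
  crossover windows of the lacunary barrier witnesses of `AxisProfileAxiomaticsNoDoubling`, where `log G` is convex in `r`).

No `sorry`; axioms propext / Classical.choice / Quot.sound; no definitions.  Landed from the lead seat of crux
stmt-CriticalPhenomena-1981 (c19; F2 = item 6150).

References: M. Aizenman, H. Duminil-Copin, Ann. of Math. 194 (2021), arXiv:1912.07973, Remark 5.10 [AizenmanDuminilCopinAnnals2021];
A. Messager, S. Miracle-Solé, J. Stat. Phys. 17 (1977) [MessagerMiracleSoleJSP1977].
-/

noncomputable section

open Real Finset
open scoped BigOperators
open Literature.Probability.LatticeModels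

namespace Summit.CriticalPhenomena.Ising3DConformalLimit.Cruxes.TwoPointDoubling.SuperharmonicComparison

/-! ## The abstract box comparison -/

/-- **Box comparison (discrete weak-Harnack-lite).** Let `F : ℤ³ → ℝ` be positive, `≥ m > 0` on the near face
`{x₀ = k, |x₁| < k, |x₂| < k}`, and a supersolution of `Δ − B/k²` on the box `{k < x₀ < 8k, |x₁| < k, |x₂| < k}`
(`ΔF ≤ (B/k²)F` there, `B ≥ 0`).  Then `F(6k e₀) ≥ (sinh 2c / sinh 7c)·m`, `c = √(π²/2 + B + 1)`.  Minimum principle against the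
strict subsolution `sinh(μ(8k − x₀)) cos(πx₁/2k) cos(πx₂/2k)/sinh(7kμ)`, `μ = c/k`, which vanishes on the five far faces.
[cite: AizenmanDuminilCopinAnnals2021, arXiv:1912.07973 Remark 5.10] -/
theorem box_comparison {B m : ℝ} {F : Site 3 → ℝ} {k : ℕ} (hk : 1 ≤ k) (hB : 0 ≤ B) (hm : 0 < m)
    (hpos : ∀ y : Site 3, 0 < F y)
    (hnear : ∀ y : Site 3, y 0 = (k : ℤ) → (1 - (k : ℤ) ≤ y 1 ∧ y 1 ≤ (k : ℤ) - 1) →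
      (1 - (k : ℤ) ≤ y 2 ∧ y 2 ≤ (k : ℤ) - 1) → m ≤ F y)
    (hF : ∀ x : Site 3, ((k : ℤ) + 1 ≤ x 0 ∧ x 0 ≤ 8 * (k : ℤ) - 1) → (1 - (k : ℤ) ≤ x 1 ∧ x 1 ≤ (k : ℤ) - 1) →
      (1 - (k : ℤ) ≤ x 2 ∧ x 2 ≤ (k : ℤ) - 1) →
      (∑ i : Fin 3, (F (x + Pi.single i 1) + F (x - Pi.single i 1))) - 6 * F x ≤ B / (k : ℝ) ^ 2 * F x) :
    Real.sinh (2 * Real.sqrt (π ^ 2 / 2 + B + 1)) / Real.sinh (7 * Real.sqrt (π ^ 2 / 2 + B + 1)) * m ≤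
      F (Pi.single 0 ((6 * k : ℕ) : ℤ)) := by
  -- constants
  have hB0 : 0 ≤ B := hB
  set c : ℝ := Real.sqrt (π ^ 2 / 2 + B + 1) with hcdef
  have hc2 : c ^ 2 = π ^ 2 / 2 + B + 1 := Real.sq_sqrt (by positivity)
  have hcpos : 0 < c := Real.sqrt_pos.2 (by positivity)
  have hkpos : (0 : ℝ) < k := by exact_mod_cast hk
  set K : ℤ := (k : ℤ) with hKdef
  have hK1 : 1 ≤ K := by rw [hKdef]; exact_mod_cast hk
  set μ : ℝ := c / k with hμdef
  set ν : ℝ := π / (2 * k) with hνdef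
  have hμpos : 0 < μ := div_pos hcpos hkpos
  have hνpos : 0 < ν := by rw [hνdef]; positivity
  set N : ℝ := Real.sinh (7 * c) with hNdef
  have hNpos : 0 < N := Real.sinh_pos_iff.2 (by positivity)
  -- the two-point function and the comparison function
  set G : Site 3 → ℝ := F with hGdef
  have hGpos : ∀ y, 0 < G y := hpos
  set φ : Site 3 → ℝ := fun y =>
    Real.sinh (μ * (8 * k - y 0)) * Real.cos (ν * y 1) * Real.cos (ν * y 2) / N with hφdef
  have hφ : ∀ y : Site 3, φ y = Real.sinh (μ * ((8 * k : ℝ) - y 0)) * Real.cos (ν * y 1) * Real.cos (ν * y 2) / N :=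
    fun y => rfl
  have hmpos : 0 < m := hm
  set w : Site 3 → ℝ := fun y => G y - m * φ y with hwdef
  -- the box
  set t : Fin 3 → Finset ℤ := fun i => if i = 0 then Finset.Icc (K + 1) (8 * K - 1) else Finset.Icc (1 - K) (K - 1)
    with htdef
  set Ω : Finset (Site 3) := Fintype.piFinset t with hΩdef
  have memΩ : ∀ y : Site 3, y ∈ Ω ↔
      (K + 1 ≤ y 0 ∧ y 0 ≤ 8 * K - 1) ∧ (1 - K ≤ y 1 ∧ y 1 ≤ K - 1) ∧ (1 - K ≤ y 2 ∧ y 2 ≤ K - 1) := by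
    intro y
    rw [hΩdef, Fintype.mem_piFinset]
    constructor
    · intro h
      have h0 := h 0
      have h1 := h 1
      have h2 := h 2
      simp only [htdef, if_pos rfl, Finset.mem_Icc] at h0
      simp only [htdef, show (1 : Fin 3) ≠ 0 by decide, if_false, Finset.mem_Icc] at h1
      simp only [htdef, show (2 : Fin 3) ≠ 0 by decide, if_false, Finset.mem_Icc] at h2
      exact ⟨h0, h1, h2⟩
    · rintro ⟨h0, h1, h2⟩ i
      fin_cases i
      · simpa [htdef] using h0
      · simpa [htdef] using h1
      · simpa [htdef] using h2
  -- cosine facts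
  have hνK : ν * k = π / 2 := by rw [hνdef]; field_simp
  have hcos_pos : ∀ z : ℤ, 1 - K ≤ z → z ≤ K - 1 → 0 < Real.cos (ν * z) := by
    intro z hz1 hz2
    apply Real.cos_pos_of_mem_Ioo
    have hz1' : (1 : ℝ) - k ≤ z := by
      have : ((1 - K : ℤ) : ℝ) ≤ z := by exact_mod_cast hz1
      push_cast [hKdef] at this; linarith
    have hz2' : (z : ℝ) ≤ k - 1 := by
      have : (z : ℝ) ≤ ((K - 1 : ℤ) : ℝ) := by exact_mod_cast hz2
      push_cast [hKdef] at this; linarith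
    constructor
    · have : ν * ((1 : ℝ) - k) ≤ ν * z := mul_le_mul_of_nonneg_left hz1' hνpos.le
      have e : ν * ((1 : ℝ) - k) = ν - π / 2 := by rw [mul_sub, hνK]; ring
      linarith
    · have : ν * (z : ℝ) ≤ ν * (k - 1) := mul_le_mul_of_nonneg_left hz2' hνpos.le
      have e : ν * ((k : ℝ) - 1) = π / 2 - ν := by rw [mul_sub, hνK]; ring
      linarith
  have hcos_K : Real.cos (ν * (K : ℤ)) = 0 := by
    have : ((K : ℤ) : ℝ) = k := by rw [hKdef]; push_cast; ring
    rw [this, hνK, Real.cos_pi_div_two]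
  have hcos_negK : Real.cos (ν * ((-K : ℤ) : ℝ)) = 0 := by
    have : ((-K : ℤ) : ℝ) = -k := by rw [hKdef]; push_cast; ring
    rw [this, mul_neg, Real.cos_neg, hνK, Real.cos_pi_div_two]
  -- the boundary estimate: on the lattice boundary of Ω, m φ ≤ G
  have hbdry : ∀ y : Site 3, (K ≤ y 0 ∧ y 0 ≤ 8 * K) → (-K ≤ y 1 ∧ y 1 ≤ K) → (-K ≤ y 2 ∧ y 2 ≤ K) →
      y ∉ Ω → m * φ y ≤ G y := by
    intro y hy0 hy1 hy2 hout
    rw [memΩ] at hout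
    have hcase : y 0 = 8 * K ∨ y 1 = K ∨ y 1 = -K ∨ y 2 = K ∨ y 2 = -K ∨
        (y 0 = K ∧ (1 - K ≤ y 1 ∧ y 1 ≤ K - 1) ∧ (1 - K ≤ y 2 ∧ y 2 ≤ K - 1)) := by omega
    rcases hcase with h | h | h | h | h | ⟨h0, h1, h2⟩
    · -- far face x₀ = 8k : φ = 0
      have : φ y = 0 := by
        rw [hφ y, h]
        have : μ * ((8 * k : ℝ) - ((8 * K : ℤ) : ℝ)) = 0 := by rw [hKdef]; push_cast; ring
        rw [this, Real.sinh_zero]; simp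
      rw [this, mul_zero]; exact (hGpos y).le
    · have : φ y = 0 := by rw [hφ y, h, hcos_K]; simp
      rw [this, mul_zero]; exact (hGpos y).le
    · have : φ y = 0 := by rw [hφ y, h, hcos_negK]; simp
      rw [this, mul_zero]; exact (hGpos y).le
    · have : φ y = 0 := by rw [hφ y, h, hcos_K]; simp
      rw [this, mul_zero]; exact (hGpos y).le
    · have : φ y = 0 := by rw [hφ y, h, hcos_negK]; simp
      rw [this, mul_zero]; exact (hGpos y).le
    · -- near face x₀ = k : φ ≤ 1 and G ≥ g(3k) = m
      have hsinh : Real.sinh (μ * ((8 * k : ℝ) - ((y 0 : ℤ) : ℝ))) = N := by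
        rw [h0, hNdef]
        congr 1
        rw [hKdef, hμdef]; push_cast; field_simp; ring
      have hφle : φ y ≤ 1 := by
        rw [hφ y, hsinh]
        have c1 := Real.cos_le_one (ν * y 1)
        have c2 := Real.cos_le_one (ν * y 2)
        have c1p := hcos_pos (y 1) h1.1 h1.2
        have c2p := hcos_pos (y 2) h2.1 h2.2
        rw [div_le_one hNpos]
        calc N * Real.cos (ν * y 1) * Real.cos (ν * y 2) ≤ N * 1 * 1 := by
              apply mul_le_mul (mul_le_mul_of_nonneg_left c1 hNpos.le) c2 c2p.le (by positivity)
          _ = N := by ring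
      have hFy : m ≤ G y := hnear y (by rw [h0, hKdef]) (by rw [hKdef] at h1; exact h1) (by rw [hKdef] at h2; exact h2)
      calc m * φ y ≤ m * 1 := mul_le_mul_of_nonneg_left hφle hmpos.le
        _ = m := mul_one m
        _ ≤ G y := hFy
  -- the minimum principle: w ≥ 0 on Ω
  have hmain : ∀ y ∈ Ω, 0 ≤ w y := by
    by_contra hneg
    push Not at hneg
    obtain ⟨y₁, hy₁, hwy₁⟩ := hneg
    obtain ⟨x₀, hx₀, hmin⟩ := Ω.exists_min_image w ⟨y₁, hy₁⟩
    have hw0 : w x₀ < 0 := (hmin y₁ hy₁).trans_lt hwy₁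
    obtain ⟨⟨h00, h01⟩, ⟨h10, h11⟩, ⟨h20, h21⟩⟩ := (memΩ x₀).1 hx₀
    -- every neighbour value is ≥ w x₀
    have hnb : ∀ i : Fin 3, w x₀ ≤ w (x₀ + Pi.single i 1) ∧ w x₀ ≤ w (x₀ - Pi.single i 1) := by
      intro i
      refine ⟨?_, ?_⟩
      · by_cases hin : x₀ + Pi.single i 1 ∈ Ω
        · exact hmin _ hin
        · have hb : m * φ (x₀ + Pi.single i 1) ≤ G (x₀ + Pi.single i 1) := by
            refine hbdry _ ?_ ?_ ?_ hin
            all_goals fin_cases i <;> simp <;> omega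
          have : 0 ≤ w (x₀ + Pi.single i 1) := by simp only [hwdef]; linarith
          exact hw0.le.trans this
      · by_cases hin : x₀ - Pi.single i 1 ∈ Ω
        · exact hmin _ hin
        · have hb : m * φ (x₀ - Pi.single i 1) ≤ G (x₀ - Pi.single i 1) := by
            refine hbdry _ ?_ ?_ ?_ hin
            all_goals fin_cases i <;> simp <;> omega
          have : 0 ≤ w (x₀ - Pi.single i 1) := by simp only [hwdef]; linarith
          exact hw0.le.trans this
    have hlapw : 0 ≤ (∑ i : Fin 3, (w (x₀ + Pi.single i 1) + w (x₀ - Pi.single i 1))) - 6 * w x₀ :=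
      lattice_laplacian_nonneg_of_le_neighbours hnb
    -- linearity of the Laplacian
    have hlin : (∑ i : Fin 3, (w (x₀ + Pi.single i 1) + w (x₀ - Pi.single i 1))) - 6 * w x₀ =
        ((∑ i : Fin 3, (G (x₀ + Pi.single i 1) + G (x₀ - Pi.single i 1))) - 6 * G x₀) -
          m * ((∑ i : Fin 3, (φ (x₀ + Pi.single i 1) + φ (x₀ - Pi.single i 1))) - 6 * φ x₀) := by
      simp only [hwdef, Fin.sum_univ_three]
      ring
    -- the eigenrelation of φ
    set lam : ℝ := 2 * (Real.cosh μ - 1) - 4 * (1 - Real.cos ν) with hlamdef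
    have hlapφ : (∑ i : Fin 3, (φ (x₀ + Pi.single i 1) + φ (x₀ - Pi.single i 1))) - 6 * φ x₀ = lam * φ x₀ :=
      lattice_laplacian_prod_eigen hφ x₀
    -- the hypothesis at x₀ and the potential V = B/k²
    set V : ℝ := B / (k : ℝ) ^ 2 with hVdef
    have hV0 : 0 ≤ V := div_nonneg hB0 (sq_nonneg _)
    have hGV : (∑ i : Fin 3, (G (x₀ + Pi.single i 1) + G (x₀ - Pi.single i 1))) - 6 * G x₀ ≤ V * G x₀ :=
      hF x₀ ⟨by rw [hKdef] at h00; exact_mod_cast h00, by rw [hKdef] at h01; exact_mod_cast h01⟩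
        ⟨by rw [hKdef] at h10; exact h10, by rw [hKdef] at h11; exact h11⟩
        ⟨by rw [hKdef] at h20; exact h20, by rw [hKdef] at h21; exact h21⟩
    have hlam : (B + 1) / (k : ℝ) ^ 2 ≤ lam := by
      have h1 := sq_div_two_le_cosh_sub_one μ hμpos.le
      have h2 : 1 - ν ^ 2 / 2 ≤ Real.cos ν := Real.one_sub_sq_div_two_le_cos
      have h3 : μ ^ 2 - 2 * ν ^ 2 = (B + 1) / (k : ℝ) ^ 2 := by
        rw [hμdef, hνdef, div_pow, div_pow, hc2]
        field_simp
        ring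
      rw [hlamdef, ← h3]
      linarith
    have hVlam : V < lam := by
      have : B / (k : ℝ) ^ 2 < (B + 1) / (k : ℝ) ^ 2 := div_lt_div_of_pos_right (by linarith) (by positivity)
      rw [hVdef]; linarith
    -- φ(x₀) > 0
    have hφpos : 0 < φ x₀ := by
      rw [hφ x₀]
      apply div_pos _ hNpos
      have hs : 0 < Real.sinh (μ * ((8 * k : ℝ) - ((x₀ 0 : ℤ) : ℝ))) := by
        apply Real.sinh_pos_iff.2
        apply mul_pos hμpos
        have : ((x₀ 0 : ℤ) : ℝ) ≤ ((8 * K - 1 : ℤ) : ℝ) := by exact_mod_cast h01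
        push_cast [hKdef] at this; linarith
      exact mul_pos (mul_pos hs (hcos_pos _ h10 h11)) (hcos_pos _ h20 h21)
    have hprod : m * V * φ x₀ < m * lam * φ x₀ :=
      mul_lt_mul_of_pos_right (mul_lt_mul_of_pos_left hVlam hmpos) hφpos
    have hVw : V * G x₀ - m * V * φ x₀ ≤ 0 := by
      have : V * (G x₀ - m * φ x₀) ≤ 0 := mul_nonpos_of_nonneg_of_nonpos hV0 (by simpa [hwdef] using hw0.le)
      linarith [this, show V * (G x₀ - m * φ x₀) = V * G x₀ - m * V * φ x₀ by ring]
    -- contradiction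
    rw [hlin, hlapφ] at hlapw
    nlinarith [hlapw, hGV, hprod, hVw]
  -- evaluate at the target point 6k e₀
  set xt : Site 3 := Pi.single 0 ((6 * k : ℕ) : ℤ) with hxtdef
  have hxt : xt ∈ Ω := by
    rw [memΩ]
    refine ⟨⟨?_, ?_⟩, ⟨?_, ?_⟩, ⟨?_, ?_⟩⟩ <;> simp [hxtdef] <;> omega
  have hφt : φ xt = Real.sinh (2 * c) / Real.sinh (7 * c) := by
    rw [hφ xt]
    have e0 : ((xt 0 : ℤ) : ℝ) = 6 * k := by simp [hxtdef]
    have e1 : ((xt 1 : ℤ) : ℝ) = 0 := by simp [hxtdef]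
    have e2 : ((xt 2 : ℤ) : ℝ) = 0 := by simp [hxtdef]
    rw [e0, e1, e2, mul_zero, Real.cos_zero, mul_one, mul_one]
    congr 1
    rw [hμdef]; congr 1; field_simp; ring
  have h := hmain xt hxt
  simp only [hwdef, sub_nonneg, hφt] at h
  -- h : m * (sinh 2c / sinh 7c) ≤ G xt
  calc Real.sinh (2 * c) / Real.sinh (7 * c) * m = m * (Real.sinh (2 * c) / Real.sinh (7 * c)) := by ring
    _ ≤ G xt := h
    _ = F (Pi.single 0 ((6 * k : ℕ) : ℤ)) := rfl


/-! ## Kato bounds on powers `G^θ` funnel into item 6150 -/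

/-- **Comparison step for a power of the two-point function.** If `θ > 0` and `Δ(G^θ)(x) ≤ A·G(x)^θ/‖x‖²` for all `x ≠ 0`
(`G = criticalTwoPoint 3`), then `(sinh 2c/sinh 7c)^{1/θ}·g(3k) ≤ g(6k)` for every `k ≥ 1`, `c = √(π²/2 + max A 0 + 1)`
(`box_comparison` for `F = G^θ`, near face by the MMS sandwich `criticalTwoPoint_axis_sandwich`).
[cite: AizenmanDuminilCopinAnnals2021, arXiv:1912.07973 Remark 5.10] [cite: MessagerMiracleSoleJSP1977, main theorem] -/
theorem doubling_three_mul_of_kato_rpow {θ A : ℝ} (hθ : 0 < θ)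
    (hA : ∀ x : Site 3, x ≠ 0 →
      (∑ i : Fin 3, (criticalTwoPoint 3 (x + Pi.single i 1) ^ θ + criticalTwoPoint 3 (x - Pi.single i 1) ^ θ)) -
        6 * criticalTwoPoint 3 x ^ θ ≤ A * criticalTwoPoint 3 x ^ θ / ‖x‖ ^ 2)
    {k : ℕ} (hk : 1 ≤ k) :
    (Real.sinh (2 * Real.sqrt (π ^ 2 / 2 + max A 0 + 1)) / Real.sinh (7 * Real.sqrt (π ^ 2 / 2 + max A 0 + 1))) ^ (1 / θ) *
        criticalTwoPoint 3 (Pi.single 0 ((3 * k : ℕ) : ℤ)) ≤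
      criticalTwoPoint 3 (Pi.single 0 ((6 * k : ℕ) : ℤ)) := by
  set B : ℝ := max A 0 with hBdef
  have hB0 : 0 ≤ B := le_max_right _ _
  have hAB : A ≤ B := le_max_left _ _
  have hkpos : (0 : ℝ) < k := by exact_mod_cast hk
  have hGpos : ∀ y : Site 3, 0 < criticalTwoPoint 3 y := fun y => criticalTwoPoint_pos_of_three_le le_rfl y
  set F : Site 3 → ℝ := fun y => criticalTwoPoint 3 y ^ θ with hFdef
  have hFpos : ∀ y, 0 < F y := fun y => Real.rpow_pos_of_pos (hGpos y) θ
  set g3 : ℝ := criticalTwoPoint 3 (Pi.single 0 ((3 * k : ℕ) : ℤ)) with hg3def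
  have hg3pos : 0 < g3 := criticalTwoPoint_axis_pos (3 * k)
  set m : ℝ := g3 ^ θ with hmdef
  have hmpos : 0 < m := Real.rpow_pos_of_pos hg3pos θ
  -- near face: MMS sandwich, then monotonicity of t ↦ t^θ
  have hnear : ∀ y : Site 3, y 0 = (k : ℤ) → (1 - (k : ℤ) ≤ y 1 ∧ y 1 ≤ (k : ℤ) - 1) →
      (1 - (k : ℤ) ≤ y 2 ∧ y 2 ≤ (k : ℤ) - 1) → m ≤ F y := by
    intro y h0 h1 h2
    have hsup : Site.supNorm y = k := by
      apply le_antisymm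
      · apply Finset.sup_le
        intro i _
        fin_cases i <;> simp <;> omega
      · have := Site.natAbs_le_supNorm y 0
        have e : (y 0).natAbs = k := by rw [h0]; simp
        omega
    have hsand := (criticalTwoPoint_axis_sandwich (y := y) (by omega)).1
    rw [hsup] at hsand
    exact Real.rpow_le_rpow hg3pos.le hsand hθ.le
  -- the Kato bound on the box, at relative size B/k²
  have hF : ∀ x : Site 3, ((k : ℤ) + 1 ≤ x 0 ∧ x 0 ≤ 8 * (k : ℤ) - 1) → (1 - (k : ℤ) ≤ x 1 ∧ x 1 ≤ (k : ℤ) - 1) →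
      (1 - (k : ℤ) ≤ x 2 ∧ x 2 ≤ (k : ℤ) - 1) →
      (∑ i : Fin 3, (F (x + Pi.single i 1) + F (x - Pi.single i 1))) - 6 * F x ≤ B / (k : ℝ) ^ 2 * F x := by
    intro x h0 _ _
    have hxne : x ≠ 0 := by
      intro h
      rw [h] at h0
      simp at h0
      omega
    have hnorm : (k : ℝ) ≤ ‖x‖ := by
      have h1 : ‖x 0‖ ≤ ‖x‖ := norm_le_pi_norm x 0
      rw [Int.norm_eq_abs] at h1
      have h2 : ((x 0 : ℤ) : ℝ) ≤ |((x 0 : ℤ) : ℝ)| := le_abs_self _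
      have h3 : (k : ℝ) + 1 ≤ ((x 0 : ℤ) : ℝ) := by exact_mod_cast h0.1
      linarith
    have hx := hA x hxne
    have h1 : A * criticalTwoPoint 3 x ^ θ / ‖x‖ ^ 2 ≤ B * criticalTwoPoint 3 x ^ θ / ‖x‖ ^ 2 :=
      div_le_div_of_nonneg_right (mul_le_mul_of_nonneg_right hAB (hFpos x).le) (sq_nonneg _)
    have h2 : B * criticalTwoPoint 3 x ^ θ / ‖x‖ ^ 2 ≤ B * criticalTwoPoint 3 x ^ θ / (k : ℝ) ^ 2 :=
      div_le_div_of_nonneg_left (mul_nonneg hB0 (hFpos x).le) (by positivity) (pow_le_pow_left₀ hkpos.le hnorm 2)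
    have h3 : B * criticalTwoPoint 3 x ^ θ / (k : ℝ) ^ 2 = B / (k : ℝ) ^ 2 * F x := by simp only [hFdef]; ring
    simpa [hFdef] using ((hx.trans h1).trans h2).trans_eq h3
  have hbox := box_comparison hk hB0 hmpos hFpos hnear hF
  -- hbox : κ₀ * g(3k)^θ ≤ G(6k e₀)^θ ; take θ⁻¹-th powers
  set κ₀ : ℝ := Real.sinh (2 * Real.sqrt (π ^ 2 / 2 + B + 1)) / Real.sinh (7 * Real.sqrt (π ^ 2 / 2 + B + 1)) with hκ₀def
  have hcpos : 0 < Real.sqrt (π ^ 2 / 2 + B + 1) := Real.sqrt_pos.2 (by positivity)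
  have hκ₀pos : 0 < κ₀ := div_pos (Real.sinh_pos_iff.2 (by positivity)) (Real.sinh_pos_iff.2 (by positivity))
  have hθne : θ ≠ 0 := hθ.ne'
  have hlhs : (κ₀ * m) ^ (1 / θ) = κ₀ ^ (1 / θ) * g3 := by
    rw [Real.mul_rpow hκ₀pos.le hmpos.le, hmdef, one_div, Real.rpow_rpow_inv hg3pos.le hθne]
  have hrhs : (F (Pi.single 0 ((6 * k : ℕ) : ℤ))) ^ (1 / θ) = criticalTwoPoint 3 (Pi.single 0 ((6 * k : ℕ) : ℤ)) := by
    simp only [hFdef]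
    rw [one_div, Real.rpow_rpow_inv (hGpos _).le hθne]
  have hmono := Real.rpow_le_rpow (mul_nonneg hκ₀pos.le hmpos.le) hbox (by positivity : (0 : ℝ) ≤ 1 / θ)
  rw [hlhs, hrhs] at hmono
  exact hmono

/-- **A Kato bound on some power `G^θ` (`θ > 0`) funnels into item 6150.** If `Δ(G^θ)(x) ≤ A·G(x)^θ/‖x‖²` for all `x ≠ 0`
(`G = criticalTwoPoint 3`, six-neighbour Laplacian, sup norm) then `TwoPointDoubling`: `∃ κ > 0, ∀ n ≥ 1, κ g(n) ≤ g(2n)`.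
For `θ = 1` this is `twoPointDoubling_of_oneSidedKato`; the hypothesis weakens as `θ ↓ 0` (power means), towards one-sided control
of `Δ log G`. [cite: AizenmanDuminilCopinAnnals2021, arXiv:1912.07973 Remark 5.10 and §5.5] [cite: MessagerMiracleSoleJSP1977, main theorem] -/
theorem twoPointDoubling_of_kato_rpow {θ : ℝ} (hθ : 0 < θ)
    (h : ∃ A : ℝ, ∀ x : Site 3, x ≠ 0 →
      (∑ i : Fin 3, (criticalTwoPoint 3 (x + Pi.single i 1) ^ θ + criticalTwoPoint 3 (x - Pi.single i 1) ^ θ)) -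
        6 * criticalTwoPoint 3 x ^ θ ≤ A * criticalTwoPoint 3 x ^ θ / ‖x‖ ^ 2) :
    Summit.CriticalPhenomena.Ising3DConformalLimit.Theses.MirrorHoelderCompactness.TwoPointDoubling := by
  obtain ⟨A, hA⟩ := h
  set c : ℝ := Real.sqrt (π ^ 2 / 2 + max A 0 + 1) with hcdef
  have hcpos : 0 < c := Real.sqrt_pos.2 (by positivity)
  set κ₀ : ℝ := (Real.sinh (2 * c) / Real.sinh (7 * c)) ^ (1 / θ) with hκ₀def
  have h7 : 0 < Real.sinh (7 * c) := Real.sinh_pos_iff.2 (by positivity)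
  have hκ₀pos : 0 < κ₀ := Real.rpow_pos_of_pos (div_pos (Real.sinh_pos_iff.2 (by positivity)) h7) _
  obtain ⟨r, hr, hr1, hstep⟩ := axis_ratio_lower_greenComparison
  have hiter := axis_ratio_iter_greenComparison hr hstep
  refine ⟨κ₀ * r ^ 3, by positivity, fun n hn => ?_⟩
  obtain ⟨k, hk1, hk2, hk3⟩ : ∃ k : ℕ, 1 ≤ k ∧ n ≤ 3 * k ∧ 3 * k ≤ n + 3 := ⟨n / 3 + 1, by omega, by omega, by omega⟩
  have e1 : criticalTwoPoint 3 (Pi.single 0 ((6 * k : ℕ) : ℤ)) ≤ criticalTwoPoint 3 (Pi.single 0 (2 * (n : ℤ))) := by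
    have := criticalTwoPoint_axis_antitone (show 2 * n ≤ 6 * k by omega)
    have e : (Pi.single 0 (2 * (n : ℤ)) : Site 3) = Pi.single 0 (((2 * n : ℕ) : ℤ)) := by push_cast; rfl
    rw [e]
    exact this
  have e2 : κ₀ * criticalTwoPoint 3 (Pi.single 0 ((3 * k : ℕ) : ℤ)) ≤ criticalTwoPoint 3 (Pi.single 0 ((6 * k : ℕ) : ℤ)) :=
    doubling_three_mul_of_kato_rpow hθ hA hk1
  have e3 : r ^ (3 * k - n) * criticalTwoPoint 3 (Pi.single 0 (n : ℤ)) ≤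
      criticalTwoPoint 3 (Pi.single 0 ((3 * k : ℕ) : ℤ)) := by
    have := hiter (3 * k - n) n hn
    rwa [show n + (3 * k - n) = 3 * k by omega] at this
  have e4 : r ^ 3 ≤ r ^ (3 * k - n) := pow_le_pow_of_le_one hr.le hr1 (by omega)
  have hgn : 0 < criticalTwoPoint 3 (Pi.single 0 (n : ℤ)) := criticalTwoPoint_axis_pos n
  calc κ₀ * r ^ 3 * criticalTwoPoint 3 (Pi.single 0 (n : ℤ))
      ≤ κ₀ * (r ^ (3 * k - n) * criticalTwoPoint 3 (Pi.single 0 (n : ℤ))) := by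
        rw [mul_assoc]
        exact mul_le_mul_of_nonneg_left (mul_le_mul_of_nonneg_right e4 hgn.le) hκ₀pos.le
    _ ≤ κ₀ * criticalTwoPoint 3 (Pi.single 0 ((3 * k : ℕ) : ℤ)) := mul_le_mul_of_nonneg_left e3 hκ₀pos.le
    _ ≤ criticalTwoPoint 3 (Pi.single 0 ((6 * k : ℕ) : ℤ)) := e2
    _ ≤ criticalTwoPoint 3 (Pi.single 0 (2 * (n : ℤ))) := e1

end Summit.CriticalPhenomena.Ising3DConformalLimit.Cruxes.TwoPointDoubling.SuperharmonicComparison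

end
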